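import Literature.AlgebraicGeometry.Motives.AbelianVarietyTangentTranslation
import Literature.AlgebraicGeometry.Motives.AbelianVarietyGoodReductionHom
import HarnessLib

/-!
# Homomorphisms killing the points at the origin form a two-sided ideal; the reduction of a
# homomorphism lying in `𝔮 · Hom(A, B)` kills the tangent vectors killed by `ι̃(𝔮)` (Shimura 1998, §2.8, §13.1)

Topic `Literature/AlgebraicGeometry/Motives`, namespace `Literature.AlgebraicGeometry.Motives.AbelianVariety`.
THEOREMS ONLY (no definition of a notion, no instance, no named fact; net Literature debt 0).  Cell
`hodgecm-mathlib` (D-0151), fan A rung A-II (h21), EDITION E2 «height-one road» for the degree-one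
Shimura–Taniyama congruence `shimuraTaniyamaPair_degOne'` ([Shimura1998] §13.1 Thm. 1 (i) at `N𝔭 = p`,
p. 129), piece R3 of A-p08's μ-FREE repair of steps S1–S3 of A-p02's road memo
`ROAD-E2-heightOne-S2degOne.md`: the vanishing of the differential `δλ̃` of the reduced `𝔮`-multiplication
is deduced from that of the `δι̃(α)`, `α ∈ 𝔮`, WITHOUT the auxiliary multiplication `μ : B → A` of the
printed proof (p. 129 «`μ ∘ λ = ι(α)`»), whose reduction would require a `HomReduction S R` that the fact
does not bind.  Instead: `λ = Σᵢ ι_A(αᵢ) ∘ λ_{γᵢ}` with `αᵢ ∈ 𝔮` (`CMTypeUniformizationMultiplicationsRational`),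
so `λ̃ = Σᵢ ι̃_A(αᵢ) ∘ λ̃_{γᵢ}` and the present file's ideal property applies.

The currency of tangent vectors is that of `AbelianVarietyLie` / `AbelianVarietyTangentTranslation`
(Görtz–Wedhorn II Rem. 27.18 (4): `Lie(A) = Ker(A(K[ε]) → A(K))`): points `t : Spec R → A` over `K` with
`Spec aug ≫ t = 1` for an augmentation `aug : R → R₀` of `K`-algebras, and «`f` kills `t`» means
`t ≫ f = 1` in the group `A(R) = Hom_K(Spec R, A)`.

* §1 Points of sums and composites: `t ≫ (f + g) = (t ≫ f) · (t ≫ g)`, `t ≫ 0 = 1`, `t ≫ (Σ fᵢ) = ∏ (t ≫ fᵢ)`,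
  `t ≫ (f ≫ h) = (t ≫ f) ≫ h`, `1 ≫ h = 1` (Mumford §19: «`Hom(X, Y)` […] `(f + g)(x) = f(x) + g(x)`»).
* §2 **The homomorphisms killing the `R`-points at the origin form a two-sided ideal** of the preadditive
  category of abelian varieties: closed under `+`, `0`, `Σ`, `−`, and under composition ON EITHER SIDE with
  arbitrary homomorphisms (`forall_comp_eq_one_add/_zero/_sum/_neg/_comp_of_left/_comp_of_right`), hence
  `f = Σᵢ eᵢ ≫ gᵢ` kills as soon as every `eᵢ` does (`forall_comp_eq_one_of_eq_sum_comp`).  For `R = L[ε]`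
  this is the statement that `{f | δf = 0}` is an ideal ([Shimura1998] §2.8: `δ(λ + μ) = δλ + δμ`,
  `δ(λμ) = δμ δλ`).
* §3 **Reduction**: for a reduction-of-homomorphisms datum `H : HomReduction R S` ([Shimura1998] §11.1
  Prop. 12) and `λ = Σᵢ aᵢ ≫ gᵢ` (`aᵢ ∈ End A₀`, `gᵢ : A₀ → B₀`), `λ̃ = Σᵢ ãᵢ ≫ g̃ᵢ`
  (`redHom_sum_comp`), so `λ̃` kills every `R`-point at the origin of `Ā` killed by all
  the `ãᵢ` (`forall_comp_redHom_eq_one_of_eq_sum`) — the shape in which the E2 assembly consumes P1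
  («`δι̃(α) = 0` for `α ∈ 𝔮 = g(𝔭)`», [Shimura1998] §13.1 proof of Thm. 1, p. 98; §18.6 p. 129).

HC_CM is proved only modulo the 7 printed citations until rung 0 closes.

## References
* [Shimura1998] G. Shimura, *Abelian Varieties with Complex Multiplication and Modular Functions* (1998),
  §2.8 (the differential `δλ` of a homomorphism; Prop. 6), §11.1 Prop. 12, §13.1 proof of Thm. 1 (p. 98),
  §18.6 proof of Thm. 18.6 (p. 129).
* [MumfordAV1970] D. Mumford, *Abelian Varieties* (1970), §19 (first paragraph: `Hom(X, Y)`).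
* [GortzWedhorn2023] U. Görtz, T. Wedhorn, *Algebraic Geometry II*, Rem. 27.18 (1)–(4).
-/

universe u

open CategoryTheory AlgebraicGeometry IsDedekindDomain
open scoped MonObj NumberField
open Literature.AlgebraicGeometry.Motives.AlgPoints

noncomputable section

namespace Literature.AlgebraicGeometry.Motives

namespace AbelianVariety

/-! ## §1 Points of sums, of zero and of composites -/

section Points

variable {K : Type u} [Field K] {A B C : AbelianVariety K} {T : SchemeOver K}

/-- **`(f + g)(t) = f(t) · g(t)`** on `T`-valued points (Mumford §19: `Hom(X, Y)` is a group under
pointwise addition; the group `A(T) = Hom(T, A)` written multiplicatively). [cite: MumfordAV1970, §19 (Hom(X,Y), first paragraph)] -/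
theorem comp_hom_hom_hom_add (t : T ⟶ A.X) (f g : A ⟶ B) :
    t ≫ (f + g).hom.hom.hom = (t ≫ f.hom.hom.hom) * (t ≫ g.hom.hom.hom) :=
  MonObj.comp_mul _ _ _

/-- The underlying group-scheme map of the zero homomorphism is the unit of `Hom(A.X, B.X)`. [cite: MumfordAV1970, §19 (Hom(X,Y), first paragraph)] -/
theorem hom_hom_hom_zero : (0 : A ⟶ B).hom.hom.hom = 1 := rfl

/-- **`0(t) = 1`** on `T`-valued points. [cite: MumfordAV1970, §19 (Hom(X,Y), first paragraph)] -/
theorem comp_hom_hom_hom_zero (t : T ⟶ A.X) : t ≫ (0 : A ⟶ B).hom.hom.hom = 1 :=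
  MonObj.comp_one _

/-- **`(Σᵢ fᵢ)(t) = ∏ᵢ fᵢ(t)`** on `T`-valued points. [cite: MumfordAV1970, §19 (Hom(X,Y), first paragraph)] -/
theorem comp_hom_hom_hom_sum {J : Type*} (t : T ⟶ A.X) (s : Finset J) (f : J → (A ⟶ B)) :
    t ≫ (∑ i ∈ s, f i).hom.hom.hom = ∏ i ∈ s, (t ≫ (f i).hom.hom.hom) := by
  classical
  induction s using Finset.induction_on with
  | empty => rw [Finset.sum_empty, Finset.prod_empty, comp_hom_hom_hom_zero]
  | insert i s hi ih => rw [Finset.sum_insert hi, Finset.prod_insert hi, comp_hom_hom_hom_add, ih]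

/-- **`(-f)(t) = f(t)⁻¹`** on `T`-valued points. [cite: MumfordAV1970, §19 (Hom(X,Y), first paragraph)] -/
theorem comp_hom_hom_hom_neg (t : T ⟶ A.X) (f : A ⟶ B) :
    t ≫ (-f).hom.hom.hom = (t ≫ f.hom.hom.hom)⁻¹ := by
  apply eq_inv_of_mul_eq_one_left
  rw [← comp_hom_hom_hom_add, neg_add_cancel]
  exact comp_hom_hom_hom_zero t

/-- `(f ≫ h)(t) = h(f(t))` on `T`-valued points (composition of underlying group-scheme maps). [cite: MumfordAV1970, §19 (Hom(X,Y), first paragraph)] -/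
theorem comp_hom_hom_hom_comp (t : T ⟶ A.X) (f : A ⟶ B) (h : B ⟶ C) :
    t ≫ (f ≫ h).hom.hom.hom = (t ≫ f.hom.hom.hom) ≫ h.hom.hom.hom :=
  (Category.assoc _ _ _).symm

/-- **`h(1) = 1`**: a homomorphism maps the unit point to the unit point. [cite: MumfordAV1970, §19 (Hom(X,Y), first paragraph)] -/
theorem one_comp_hom_hom_hom (h : B ⟶ C) : (1 : T ⟶ B.X) ≫ h.hom.hom.hom = 1 :=
  MonObj.one_comp _

end Points

/-! ## §2 The homomorphisms killing the points at the origin form a two-sided ideal -/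

section Kills

variable {K : Type u} [Field K] {A B C : AbelianVariety K}
  {R R₀ : Type u} [CommRing R] [Algebra K R] [CommRing R₀] [Algebra K R₀] (aug : R →ₐ[K] R₀)

/-- **Sum**: if `f` and `g` kill every `R`-point of `A` at the origin, so does `f + g`
([Shimura1998] §2.8: `δ(λ + μ) = δλ + δμ`). [cite: Shimura1998, §2.8 (the differential of a homomorphism)] -/
theorem forall_comp_eq_one_add {f g : A ⟶ B}
    (hf : ∀ t : specOver K R ⟶ A.X, specOverMapOfAlgHom aug ≫ t = 1 → t ≫ f.hom.hom.hom = 1)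
    (hg : ∀ t : specOver K R ⟶ A.X, specOverMapOfAlgHom aug ≫ t = 1 → t ≫ g.hom.hom.hom = 1)
    (t : specOver K R ⟶ A.X) (ht : specOverMapOfAlgHom aug ≫ t = 1) :
    t ≫ (f + g).hom.hom.hom = 1 := by
  rw [comp_hom_hom_hom_add, hf t ht, hg t ht, mul_one]

/-- **Zero** kills every point. [cite: Shimura1998, §2.8 (the differential of a homomorphism)] -/
theorem forall_comp_eq_one_zero (t : specOver K R ⟶ A.X) (_ht : specOverMapOfAlgHom aug ≫ t = 1) :
    t ≫ (0 : A ⟶ B).hom.hom.hom = 1 :=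
  comp_hom_hom_hom_zero t

/-- **Negation**: if `f` kills every `R`-point at the origin, so does `-f`. [cite: Shimura1998, §2.8 (the differential of a homomorphism)] -/
theorem forall_comp_eq_one_neg {f : A ⟶ B}
    (hf : ∀ t : specOver K R ⟶ A.X, specOverMapOfAlgHom aug ≫ t = 1 → t ≫ f.hom.hom.hom = 1)
    (t : specOver K R ⟶ A.X) (ht : specOverMapOfAlgHom aug ≫ t = 1) :
    t ≫ (-f).hom.hom.hom = 1 := by
  rw [comp_hom_hom_hom_neg, hf t ht, inv_one]

/-- **Finite sums**: if every `f i`, `i ∈ s`, kills every `R`-point at the origin, so does `Σ_{i ∈ s} f i`.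
[cite: Shimura1998, §2.8 (the differential of a homomorphism)] -/
theorem forall_comp_eq_one_sum {J : Type*} (s : Finset J) {f : J → (A ⟶ B)}
    (hf : ∀ i ∈ s, ∀ t : specOver K R ⟶ A.X, specOverMapOfAlgHom aug ≫ t = 1 → t ≫ (f i).hom.hom.hom = 1)
    (t : specOver K R ⟶ A.X) (ht : specOverMapOfAlgHom aug ≫ t = 1) :
    t ≫ (∑ i ∈ s, f i).hom.hom.hom = 1 := by
  rw [comp_hom_hom_hom_sum]
  exact Finset.prod_eq_one fun i hi ↦ hf i hi t ht

/-- **Right multiples**: if `f : A → B` kills every `R`-point of `A` at the origin then so does `f ≫ h` for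
every `h : B → C` (`h(1) = 1`; [Shimura1998] §2.8: `δ(μλ) = δλ ∘ δμ`). [cite: Shimura1998, §2.8 (the differential of a homomorphism)] -/
theorem forall_comp_eq_one_comp_of_left {f : A ⟶ B}
    (hf : ∀ t : specOver K R ⟶ A.X, specOverMapOfAlgHom aug ≫ t = 1 → t ≫ f.hom.hom.hom = 1)
    (h : B ⟶ C) (t : specOver K R ⟶ A.X) (ht : specOverMapOfAlgHom aug ≫ t = 1) :
    t ≫ (f ≫ h).hom.hom.hom = 1 := by
  rw [comp_hom_hom_hom_comp, hf t ht, one_comp_hom_hom_hom]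

/-- A homomorphism maps points at the origin to points at the origin: if `Spec aug ≫ t = 1` then
`Spec aug ≫ (t ≫ f) = 1`. [cite: GortzWedhorn2023, Rem. 27.18 (4)] -/
theorem augMap_comp_comp_hom_eq_one (f : A ⟶ B) (t : specOver K R ⟶ A.X)
    (ht : specOverMapOfAlgHom aug ≫ t = 1) :
    specOverMapOfAlgHom aug ≫ (t ≫ f.hom.hom.hom) = 1 := by
  rw [← Category.assoc, ht, one_comp_hom_hom_hom]

/-- **Left multiples**: if `h : B → C` kills every `R`-point of `B` at the origin then so does `f ≫ h` for
every `f : A → B` (`f` maps points at the origin to points at the origin). [cite: Shimura1998, §2.8 (the differential of a homomorphism)] -/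
theorem forall_comp_eq_one_comp_of_right (f : A ⟶ B) {h : B ⟶ C}
    (hh : ∀ t : specOver K R ⟶ B.X, specOverMapOfAlgHom aug ≫ t = 1 → t ≫ h.hom.hom.hom = 1)
    (t : specOver K R ⟶ A.X) (ht : specOverMapOfAlgHom aug ≫ t = 1) :
    t ≫ (f ≫ h).hom.hom.hom = 1 := by
  rw [comp_hom_hom_hom_comp]
  exact hh _ (augMap_comp_comp_hom_eq_one aug f t ht)

/-- **`Σᵢ eᵢ ≫ gᵢ` kills as soon as every `eᵢ` does**: if `f = Σ_{i ∈ s} e i ≫ g i` with each `e i : A → B`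
killing every `R`-point of `A` at the origin, then `f` kills every `R`-point of `A` at the origin (the
two-sided ideal property; for `R = L[ε]`: `δf = Σ δgᵢ ∘ δeᵢ = 0`).  This is the shape of the E2 step
«`δλ̃ = 0`»: `λ̃ = Σ ι̃(αᵢ) ≫ λ̃_{γᵢ}` with `δι̃(αᵢ) = 0`. [cite: Shimura1998, §2.8 (the differential of a homomorphism); §13.1 proof of Thm. 1 (p. 98)] -/
theorem forall_comp_eq_one_of_eq_sum_comp {J : Type*} (s : Finset J) {e : J → (A ⟶ B)}
    {g : J → (B ⟶ C)} {f : A ⟶ C} (hfs : f = ∑ i ∈ s, e i ≫ g i)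
    (he : ∀ i ∈ s, ∀ t : specOver K R ⟶ A.X, specOverMapOfAlgHom aug ≫ t = 1 → t ≫ (e i).hom.hom.hom = 1)
    (t : specOver K R ⟶ A.X) (ht : specOverMapOfAlgHom aug ≫ t = 1) :
    t ≫ f.hom.hom.hom = 1 := by
  subst hfs
  exact forall_comp_eq_one_sum aug s
    (fun i hi ↦ forall_comp_eq_one_comp_of_left aug (he i hi) (g i)) t ht

/-- **Subgroup-closure form**: the homomorphisms killing every `R`-point at the origin contain the additive
subgroup generated by any set of such homomorphisms (closure under `0`, `+`, `−`). [cite: Shimura1998, §2.8 (the differential of a homomorphism)] -/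
theorem forall_comp_eq_one_of_mem_closure {S : Set (A ⟶ B)}
    (hS : ∀ f ∈ S, ∀ t : specOver K R ⟶ A.X, specOverMapOfAlgHom aug ≫ t = 1 → t ≫ f.hom.hom.hom = 1)
    {f : A ⟶ B} (hf : f ∈ AddSubgroup.closure S)
    (t : specOver K R ⟶ A.X) (ht : specOverMapOfAlgHom aug ≫ t = 1) :
    t ≫ f.hom.hom.hom = 1 := by
  induction hf using AddSubgroup.closure_induction with
  | mem g hg => exact hS g hg t ht
  | zero => exact comp_hom_hom_hom_zero t
  | add g g' _ _ hg hg' => rw [comp_hom_hom_hom_add, hg, hg', mul_one]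
  | neg g _ hg => rw [comp_hom_hom_hom_neg, hg, inv_one]

/-- **Left-ideal form**: if `f` lies in the additive subgroup generated by the composites `e ≫ g` with `e`
ranging over a set `E` of homomorphisms `A → B` killing every `R`-point of `A` at the origin and `g : B → C`
arbitrary, then `f` kills every `R`-point of `A` at the origin.  (E2: `E = ι_A(𝔮)`, `f` the reduced
`𝔮`-multiplication.) [cite: Shimura1998, §2.8 (the differential of a homomorphism); §13.1 proof of Thm. 1 (p. 98)] -/
theorem forall_comp_eq_one_of_mem_closure_comp {E : Set (A ⟶ B)}
    (hE : ∀ e ∈ E, ∀ t : specOver K R ⟶ A.X, specOverMapOfAlgHom aug ≫ t = 1 → t ≫ e.hom.hom.hom = 1)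
    {f : A ⟶ C} (hf : f ∈ AddSubgroup.closure {h : A ⟶ C | ∃ e ∈ E, ∃ g : B ⟶ C, h = e ≫ g})
    (t : specOver K R ⟶ A.X) (ht : specOverMapOfAlgHom aug ≫ t = 1) :
    t ≫ f.hom.hom.hom = 1 := by
  refine forall_comp_eq_one_of_mem_closure aug (fun h hh ↦ ?_) hf t ht
  obtain ⟨e, he, g, rfl⟩ := hh
  exact forall_comp_eq_one_comp_of_left aug (hE e he) g

end Kills

/-! ## §3 Reduction: `λ = Σ aᵢ ≫ gᵢ` ⇒ `λ̃ = Σ ãᵢ ≫ g̃ᵢ`, and `λ̃` kills what the `ãᵢ` kill -/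

section Reduction

variable {K : Type} [Field K] [NumberField K] {A₀ B₀ : AbelianVariety K} {v : HeightOneSpectrum (𝓞 K)}
  {R : A₀.GoodReductionAt v} {S : B₀.GoodReductionAt v}

/-- **Reduction of a sum of composites**: `(Σᵢ aᵢ ≫ gᵢ)~ = Σᵢ ãᵢ ≫ g̃ᵢ` for `aᵢ ∈ End A₀`, `gᵢ : A₀ → B₀`
(additivity of `λ ↦ λ̃` and `(e ≫ f)~ = ẽ ≫ f̃`, [Shimura1998] §11.1 Prop. 12). [cite: Shimura1998, §11.1 Prop. 12 (≈ p. 84)] -/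
theorem GoodReductionAt.HomReduction.redHom_sum_comp (H : GoodReductionAt.HomReduction R S)
    {J : Type*} (s : Finset J) (a : J → End A₀) (g : J → (A₀ ⟶ B₀)) :
    H.redHom (∑ i ∈ s, (a i : A₀ ⟶ A₀) ≫ g i) =
      ∑ i ∈ s, (R.redEnd (a i) : R.reduction ⟶ R.reduction) ≫ H.redHom (g i) := by
  rw [map_sum]
  exact Finset.sum_congr rfl fun i _ ↦ H.redEnd_comp_redHom (a i) (g i)

/-- **`λ̃` kills the `R`-points at the origin killed by the `ãᵢ`**: if `λ = Σ_{i ∈ s} aᵢ ≫ gᵢ` with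
`aᵢ ∈ End A₀`, `gᵢ : A₀ → B₀`, and every reduced endomorphism `ãᵢ = R.redEnd (a i)` kills every
`Rκ`-point of `Ā` at the origin (w.r.t. the augmentation `aug`), then so does `λ̃ = H.redHom λ`.  E2 use:
`λ` the `𝔮`-multiplication, `aᵢ = ι(αᵢ)` with `αᵢ ∈ 𝔮 = g(𝔭)` and `δι̃(αᵢ) = 0` ([Shimura1998] §13.1 proof
of Thm. 1, p. 98: «`δι̃(α) = 0` […] hence `δλ̃ = 0`», here without the auxiliary `μ`).
[cite: Shimura1998, §11.1 Prop. 12 (≈ p. 84); §13.1 proof of Thm. 1 (p. 98)] -/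
theorem GoodReductionAt.HomReduction.forall_comp_redHom_eq_one_of_eq_sum
    (H : GoodReductionAt.HomReduction R S) {J : Type*} (s : Finset J) (a : J → End A₀)
    (g : J → (A₀ ⟶ B₀)) {lam : A₀ ⟶ B₀} (hlam : lam = ∑ i ∈ s, (a i : A₀ ⟶ A₀) ≫ g i)
    {Rκ R₀ : Type} [CommRing Rκ] [Algebra v.asIdeal.ResidueField Rκ] [CommRing R₀]
    [Algebra v.asIdeal.ResidueField R₀] (aug : Rκ →ₐ[v.asIdeal.ResidueField] R₀)
    (ha : ∀ i ∈ s, ∀ t : specOver v.asIdeal.ResidueField Rκ ⟶ R.reduction.X,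
      specOverMapOfAlgHom aug ≫ t = 1 →
        t ≫ (R.redEnd (a i) : R.reduction ⟶ R.reduction).hom.hom.hom = 1)
    (t : specOver v.asIdeal.ResidueField Rκ ⟶ R.reduction.X) (ht : specOverMapOfAlgHom aug ≫ t = 1) :
    t ≫ (H.redHom lam).hom.hom.hom = 1 := by
  subst hlam
  exact forall_comp_eq_one_of_eq_sum_comp aug s (H.redHom_sum_comp s a g) ha t ht

/-- **Reduction maps the left ideal generated by `E ⊆ End A₀` into the left ideal generated by `Ẽ`**:
if `λ` lies in the additive subgroup of `Hom(A₀, B₀)` generated by the composites `a ≫ g` (`a ∈ E`,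
`g : A₀ → B₀`), then `λ̃` lies in the subgroup of `Hom(Ā, B̄)` generated by the `ã ≫ g̃`
(`λ ↦ λ̃` is additive and `(a ≫ g)~ = ã ≫ g̃`, [Shimura1998] §11.1 Prop. 12). [cite: Shimura1998, §11.1 Prop. 12 (≈ p. 84)] -/
theorem GoodReductionAt.HomReduction.redHom_mem_closure_comp (H : GoodReductionAt.HomReduction R S)
    {E : Set (End A₀)} {lam : A₀ ⟶ B₀}
    (hlam : lam ∈ AddSubgroup.closure {h : A₀ ⟶ B₀ | ∃ a ∈ E, ∃ g : A₀ ⟶ B₀, h = (a : A₀ ⟶ A₀) ≫ g}) :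
    H.redHom lam ∈ AddSubgroup.closure
      {h : R.reduction ⟶ S.reduction | ∃ e ∈ (fun a ↦ (R.redEnd a : R.reduction ⟶ R.reduction)) '' E,
        ∃ g : R.reduction ⟶ S.reduction, h = e ≫ g} := by
  have h1 : H.redHom lam ∈ (AddSubgroup.closure
      {h : A₀ ⟶ B₀ | ∃ a ∈ E, ∃ g : A₀ ⟶ B₀, h = (a : A₀ ⟶ A₀) ≫ g}).map H.redHom :=
    AddSubgroup.mem_map_of_mem H.redHom hlam
  rw [AddMonoidHom.map_closure] at h1
  refine AddSubgroup.closure_mono ?_ h1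
  rintro _ ⟨h, ⟨a, ha, g, rfl⟩, rfl⟩
  exact ⟨_, ⟨a, ha, rfl⟩, H.redHom g, H.redEnd_comp_redHom a g⟩

/-- **`λ̃` kills the `R`-points at the origin killed by `Ẽ`, subgroup-closure form**: if `λ` lies in the
additive subgroup of `Hom(A₀, B₀)` generated by the `a ≫ g` with `a` in a set `E ⊆ End A₀` all of whose
reductions `ã` kill every `Rκ`-point of `Ā` at the origin, then `λ̃ = H.redHom λ` kills every such point.
E2 use: `E = ι_A(𝔮)`, `λ` the `𝔮`-multiplication (`λ ∈ ⟨ι_A(𝔮) ≫ Hom(A₀, B₀)⟩`,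
`CMTypeUniformizationMultiplicationsRational`), `δι̃(α) = 0` for `α ∈ 𝔮 = g(𝔭)` ([Shimura1998] §13.1, p. 98).
[cite: Shimura1998, §11.1 Prop. 12 (≈ p. 84); §13.1 proof of Thm. 1 (p. 98)] -/
theorem GoodReductionAt.HomReduction.forall_comp_redHom_eq_one_of_mem_closure_comp
    (H : GoodReductionAt.HomReduction R S) {E : Set (End A₀)} {lam : A₀ ⟶ B₀}
    (hlam : lam ∈ AddSubgroup.closure {h : A₀ ⟶ B₀ | ∃ a ∈ E, ∃ g : A₀ ⟶ B₀, h = (a : A₀ ⟶ A₀) ≫ g})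
    {Rκ R₀ : Type} [CommRing Rκ] [Algebra v.asIdeal.ResidueField Rκ] [CommRing R₀]
    [Algebra v.asIdeal.ResidueField R₀] (aug : Rκ →ₐ[v.asIdeal.ResidueField] R₀)
    (ha : ∀ a ∈ E, ∀ t : specOver v.asIdeal.ResidueField Rκ ⟶ R.reduction.X,
      specOverMapOfAlgHom aug ≫ t = 1 →
        t ≫ (R.redEnd a : R.reduction ⟶ R.reduction).hom.hom.hom = 1)
    (t : specOver v.asIdeal.ResidueField Rκ ⟶ R.reduction.X) (ht : specOverMapOfAlgHom aug ≫ t = 1) :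
    t ≫ (H.redHom lam).hom.hom.hom = 1 := by
  refine forall_comp_eq_one_of_mem_closure_comp aug (E := (fun a ↦ (R.redEnd a : _ ⟶ _)) '' E)
    (fun e he ↦ ?_) (H.redHom_mem_closure_comp hlam) t ht
  obtain ⟨a, ha', rfl⟩ := he
  exact ha a ha'

end Reduction

end AbelianVariety

end Literature.AlgebraicGeometry.Motives

end
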